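import Literature.Computability.Complexity.TruthTableClosure
import HarnessLib

/-!
# Truth-table oracle transducers: the function `x ↦ G ⟨x, answer bits⟩` is in `FP^A`

Trunk `CplxCore`, a function-valued companion of `TruthTableClosure.lean` (whose `ttAlg Q q D`
*decides* the truth-table reduced language `ttLang Q q D A ∈ P^A`). A polynomial-time
**truth-table transducer** (Ladner–Lynch–Selman 1975, §3: all queries are computed before any answer
is read) is given by a query generator `Q ∈ FP` (the `i`-th query on `x` is `Q ⟨x, 1ⁱ⟩`), a
polynomial `q` (the queries are those with `i < q(|x|)`) and an **output map** `G ∈ FP`; it computes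

  `ttFn Q q G A x = G ⟨x, b₀ b₁ ⋯ b_{q(|x|)-1}⟩`,  `bᵢ = [Q ⟨x, 1ⁱ⟩ ∈ A]` (`ttBits`).

Main results: `ttFnAlg Q q G : OracleAlg (List Bool)` (ask the queries in order, then output
`G ⟨x, answers⟩`), `run_ttFnAlg`, `exists_of_mem_queries_ttFnAlg`, `isPolyTime_ttFnAlg` (its step
function as the string map `stepSF = condFn (GoOn q) (qryS Q) (outS G)`, reusing the accessors of
`TruthTableClosure.lean`), and **`ttFn_mem_FPRel`**: `ttFn Q q G A ∈ FP^A` (`FPRel (Oracle.ofLanguage A)`).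
This is the shape of the `FP^{NP^O}` machine of Stockmeyer's approximate counting (AA13 Thm. 4.1:
all threshold questions are asked non-adaptively, then the estimate is computed from the answers;
cf. the remark "a `BPP^{NP}_{tt}` approximation algorithm" in the literature on Stockmeyer's theorem).

## References

* R. E. Ladner, N. A. Lynch, A. L. Selman, *A comparison of polynomial time reducibilities*,
  Theoret. Comput. Sci. 1 (1975) 103–123, §3 (`≤ᵖₜₜ`; `≤ᵖₜₜ` implies `≤ᵖ_T`).
* S. Arora, B. Barak, *Computational Complexity: A Modern Approach*, CUP 2009, §3.4 (oracle
  machines), §17.2 (`FP` with an oracle).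
-/

namespace Literature.Computability.Complexity

open _root_.Computability Polynomial PRelSigma OracleCompose TTClosure

section TTFn

variable (Q : List Bool → List Bool) (q : Polynomial ℕ) (G : List Bool → List Bool)

/-- **The function truth-table computed from `A`**: `x ↦ G ⟨x, answer bits of the q(|x|) queries⟩`.
[Ladner–Lynch–Selman 1975, §3 (`≤ᵖₜₜ`: generator and evaluator)] [cite: LadnerLynchSelman1975, §3] -/
noncomputable def ttFn (A : Language Bool) (x : List Bool) : List Bool :=
  G (boolPair x (ttBits Q A x (q.eval x.length)))

/-- **The truth-table transducer**: while fewer than `q(|x|)` answers have been received, ask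
`Q ⟨x, 1^{#answers}⟩`; then output `G ⟨x, answers⟩` (the one-bit answers flattened to a bit string).
[Ladner–Lynch–Selman 1975, §3] [cite: LadnerLynchSelman1975, §3] -/
noncomputable def ttFnAlg : OracleAlg (List Bool) where
  step x ans :=
    if ans.length < q.eval x.length then Sum.inl (Q (boolPair x (List.replicate ans.length true)))
    else Sum.inr (G (boolPair x ans.flatten))

variable {Q q G}

/-- Unfolding lemma for `ttFn`. [folklore] -/
theorem ttFn_apply (A : Language Bool) (x : List Bool) :
    ttFn Q q G A x = G (boolPair x (ttBits Q A x (q.eval x.length))) :=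
  rfl

/-- The step of `ttFnAlg` before the last query has been answered is the next query. [folklore] -/
theorem ttFnAlg_step_of_lt (x : List Bool) {ans : List (List Bool)} (h : ans.length < q.eval x.length) :
    (ttFnAlg Q q G).step x ans = Sum.inl (Q (boolPair x (List.replicate ans.length true))) := by
  simp [ttFnAlg, h]

/-- The step of `ttFnAlg` after all answers is the output. [folklore] -/
theorem ttFnAlg_step_of_le (x : List Bool) {ans : List (List Bool)} (h : q.eval x.length ≤ ans.length) :
    (ttFnAlg Q q G).step x ans = Sum.inr (G (boolPair x ans.flatten)) := by
  simp [ttFnAlg, Nat.not_lt.2 h]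

/-- **The transcript of `ttFnAlg` is the list of intended answer bits.** [folklore] -/
theorem trans_ttFnAlg (A : Language Bool) (x : List Bool) :
    ∀ i ≤ q.eval x.length, trans (ttFnAlg Q q G) (Oracle.ofLanguage A) x i = bitsTrans (ttBits Q A x i)
  | 0, _ => by simp [ttBits]
  | i + 1, hi => by
    have ih := trans_ttFnAlg A x i (Nat.le_of_succ_le hi)
    rw [trans_succ, ih, qryOf_eq_of_step_eq (ttFnAlg_step_of_lt x (by simpa using hi)),
      ofLanguage_eq_singleton, ttBits_succ, bitsTrans_append, bitsTrans_singleton, length_bitsTrans,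
      length_ttBits]

/-- **`ttFnAlg` computes `ttFn`** within any budget of more than `q(|x|)` rounds.
[Ladner–Lynch–Selman 1975, §3] [cite: LadnerLynchSelman1975, §3] -/
theorem run_ttFnAlg (A : Language Bool) (x : List Bool) {n : ℕ} (hn : q.eval x.length < n) :
    (ttFnAlg Q q G).run (Oracle.ofLanguage A) n x = some (ttFn Q q G A x) := by
  rw [run_eq_some_iff]
  refine ⟨q.eval x.length, hn, fun i hi => ⟨Q (boolPair x (List.replicate i true)), ?_⟩, ?_⟩
  · rw [trans_ttFnAlg A x i hi.le, ttFnAlg_step_of_lt x (by simpa using hi), length_bitsTrans,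
      length_ttBits]
  · rw [trans_ttFnAlg A x _ le_rfl, ttFnAlg_step_of_le x (by simp), flatten_bitsTrans]
    rfl

/-- **The queries of `ttFnAlg` are the intended ones**: every recorded query is `Q ⟨x, 1ⁱ⟩` for some
`i < q(|x|)`. [folklore] -/
theorem exists_of_mem_queries_ttFnAlg (A : Language Bool) (x : List Bool) {n : ℕ} {y : List Bool}
    (hy : y ∈ (ttFnAlg Q q G).queries (Oracle.ofLanguage A) n x) :
    ∃ i < q.eval x.length, y = Q (boolPair x (List.replicate i true)) := by
  obtain ⟨i, -, hall, rfl⟩ := exists_of_mem_queries _ _ n x y hy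
  have hi : i < q.eval x.length := by
    by_contra hle
    obtain ⟨y', hy'⟩ := hall (q.eval x.length) (Nat.not_lt.1 hle)
    rw [trans_ttFnAlg A x _ le_rfl, ttFnAlg_step_of_le x (by simp)] at hy'
    cases hy'
  refine ⟨i, hi, ?_⟩
  rw [trans_ttFnAlg A x i hi.le, qryOf_eq_of_step_eq (ttFnAlg_step_of_lt x (by simpa using hi)),
    length_bitsTrans, length_ttBits]

/-! ### The step function of `ttFnAlg` as a string map -/

/-- The `sumBool` code of a step result of a string-valued oracle algorithm. [H21 design C2]
[folklore] -/
def stepCodeL (r : List Bool ⊕ List Bool) : List Bool :=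
  ((encodingList Bool).sumBool (encodingList Bool)).encode r

/-- The code of a query is `0 y`. [folklore] -/
@[simp] theorem stepCodeL_inl (y : List Bool) : stepCodeL (Sum.inl y) = false :: y := rfl

/-- The code of an output is `1 w`. [folklore] -/
@[simp] theorem stepCodeL_inr (w : List Bool) : stepCodeL (Sum.inr w) = true :: w := rfl

variable (G)

/-- The code `1 · G ⟨x, flattened answers⟩` of the output. [folklore] -/
noncomputable def outS : List Bool → List Bool :=
  List.cons true ∘ G ∘ pairFn fstP (flatT.eval ∘ bodA)

variable (Q q)

/-- **The step function of `ttFnAlg` as a string map.** [folklore] -/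
noncomputable def stepSF : List Bool → List Bool := condFn (GoOn q) (qryS Q) (outS G)

variable {Q q G}

/-- `outS G ∈ FP` for `G ∈ FP`. [folklore] -/
theorem outS_mem_FP (hG : G ∈ FP) : outS G ∈ FP :=
  comp_mem_FP (cons_mem_FP true) (comp_mem_FP hG
    (pairFn_mem_FP fstP_mem_FP (comp_mem_FP flatT_mem_FP bodA_mem_FP)))

/-- **`stepSF ∈ FP`.** [folklore] -/
theorem stepSF_mem_FP (hQ : Q ∈ FP) (hG : G ∈ FP) : stepSF Q q G ∈ FP :=
  condFn_mem_FP (GoOn_mem_P q) (qryS_mem_FP hQ) (outS_mem_FP hG)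

/-- The output branch computes the output code. [folklore] -/
theorem outS_apply (x : List Bool) (ans : List (List Bool)) :
    outS G (boolPair x ((encodingList Bool).listBool.encode ans)) =
      true :: G (boolPair x ans.flatten) := by
  rw [outS, Function.comp_apply, Function.comp_apply, pairFn_apply, fstP_boolPair, Function.comp_apply,
    bodA_apply, flatT_eval_body]

/-- **The string map computes the step function.** [folklore] -/
theorem stepSF_apply (x : List Bool) (ans : List (List Bool)) :
    stepSF Q q G (boolPair x ((encodingList Bool).listBool.encode ans)) =
      stepCodeL ((ttFnAlg Q q G).step x ans) := by
  by_cases h : ans.length < q.eval x.length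
  · rw [stepSF, condFn_of_mem _ _ ((mem_GoOn_iff x ans).2 h), ttFnAlg_step_of_lt x h, qryS_apply,
      stepCodeL_inl]
  · rw [stepSF, condFn_of_not_mem _ _ (fun h' => h ((mem_GoOn_iff x ans).1 h')),
      ttFnAlg_step_of_le x (Nat.not_lt.1 h), outS_apply, stepCodeL_inr]

/-- **`ttFnAlg` is polynomial-time** for `Q, G ∈ FP`. [Ladner–Lynch–Selman 1975, §3;
Arora–Barak 2009, §3.4] [cite: LadnerLynchSelman1975, §3] -/
theorem isPolyTime_ttFnAlg (hQ : Q ∈ FP) (hG : G ∈ FP) :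
    (ttFnAlg Q q G).IsPolyTime (encodingList Bool) := by
  obtain ⟨p, Mx, h⟩ := stepSF_mem_FP (q := q) hQ hG
  refine ⟨p, Mx, fun z => ?_⟩
  have hz := h (boolPair z.1 ((encodingList Bool).listBool.encode z.2))
  rw [id, stepSF_apply] at hz
  exact hz

/-! ### Main result -/

/-- **Truth-table transducers compute `FP^A` functions**: `ttFn Q q G A ∈ FP^A` for `Q, G ∈ FP`
(rounds `q + 1`, query lengths bounded through an output-length bound of `Q`, `ttBudget`).
(Ladner–Lynch–Selman 1975, §3: `≤ᵖₜₜ` implies `≤ᵖ_T`, for transducers.) [cite: LadnerLynchSelman1975, §3] -/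
theorem ttFn_mem_FPRel (hQ : Q ∈ FP) (hG : G ∈ FP) (A : Language Bool) :
    ttFn Q q G A ∈ FPRel (Oracle.ofLanguage A) := by
  obtain ⟨s, hs⟩ := exists_poly_length_le_of_mem_FP hQ
  refine ⟨ttFnAlg Q q G, isPolyTime_ttFnAlg hQ hG, ttBudget q s, fun x => ⟨?_, fun y hy => ?_⟩⟩
  · exact run_ttFnAlg A x (by rw [ttBudget_eval]; omega)
  · obtain ⟨i, hi, rfl⟩ := exists_of_mem_queries_ttFnAlg A x hy
    refine (hs _).trans ?_
    rw [ttBudget_eval, length_boolPair, List.length_replicate]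
    exact (TM2Iter.eval_mono s (by omega)).trans (Nat.le_add_left _ _)

/-- `ttFn Q q G A ∈ FP^C`-style corollary: for `A ∈ C`, `ttFn Q q G A` is computed in `FP` relative to
a member of `C`. [Ladner–Lynch–Selman 1975, §3] [cite: LadnerLynchSelman1975, §3] -/
theorem exists_mem_ttFn_mem_FPRel (hQ : Q ∈ FP) (hG : G ∈ FP) {C : Set (Language Bool)}
    {A : Language Bool} (hA : A ∈ C) :
    ∃ L ∈ C, ttFn Q q G A ∈ FPRel (Oracle.ofLanguage L) :=
  ⟨A, hA, ttFn_mem_FPRel hQ hG A⟩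

end TTFn

end Literature.Computability.Complexity
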